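import Summits.HubbardSuperconductivity.HubbardSuperconductivity.Theorems.WidthHaldaneDefs

/-!
# The width induction of route `SeamInduction`, as citable theorems:
# `PerWidthThermodynamics ∧ SeamGluingLocality ⟹ WidthUniformThermodynamics`

In route `SeamInduction` the target `WidthUniformThermodynamics` (stmt-HubbardSuperconductivity-16312,
also the rank-3 crux of route `WidthHaldane`) is not a hypothesis of the deciding theorem: it is
DERIVED from the two cruxes `PerWidthThermodynamics` (stmt-18510: per-width floors/ceilings with
width-dependent constants `d_M, k_M, L_M`) and `SeamGluingLocality` (stmt-18509: gluing two even
tubes of widths `M', M'' ≥ M₂` into one of width `M' + M''` costs at most the boundary factors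
`1 ∓ M₂/M` on the positive parts of the two intensive responses) by a strong induction on the width.
That induction lives as an anonymous `have key` inside `Theses.SeamInduction.closes` and cannot be
cited. This file lands it as theorems, in a slightly sharper POINTWISE form:

* `uniform_of_perWidth_of_gluing` — ABSTRACT WIDTH INDUCTION over two arbitrary width-indexed
  functionals `ρ, κ` (no Hubbard content): per-width data for every even `M ≥ 2` plus one-seam
  locality with constants `(M₂, L₂)` give WIDTH-UNIFORM bounds `d₀ ≤ ρ`, `0 < κ ≤ k₀` on all even
  `M₁ ≤ M ≤ L`, `L ≥ L₀` even, with the explicit threshold `M₁ = 4 M₂ + 12`. Mechanism (as in the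
  route file): base window `M ∈ [M₁, 2M₁ + 2]` with constants `inf / sup` of the per-width ones,
  unequal-width step `M ↦ (2⌊M/4⌋, M − 2⌊M/4⌋)`, invariants `ρ_M ≥ d₁ (1/4 + M₂/(2M))` and
  `κ_M ≤ k₁ (2 − 4M₂/M)` carried by the real inequalities
  `(1 − a/n)(1/4 + a/(n+2)) ≥ 1/4 + a/(2n)` (`n ≥ 4a + 6`) and `(1 + a/n)(2 − 8a/(n+2)) ≤ 2 − 4a/n`
  (`n ≥ 6`); positivity of `κ` is propagated pointwise.
* `uniformThermo_of_perWidth_of_gluing` — the same over the tube names of `Theorems/WidthHaldaneDefs`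
  (`tubeStiffness`, `tubePairCompressibility`, `UniformThermo`), POINTWISE in `(U, δ)`: per-width
  thermodynamics at `(U, δ)` and one-seam locality at `(U, δ)` with `(M₂, L₂)` give
  `UniformThermo U δ d₀ k₀ (4M₂ + 12) L₀` for some `d₀ > 0, k₀, L₀`.
* `widthUniformThermodynamics_of_perWidth_of_seamGluing` (`WidthHaldane` decl) and
  `seamInduction_widthUniformThermodynamics_of_cruxes` (`SeamInduction` copy): the target of route
  `SeamInduction` from its two cruxes — `X_of_subs` of the route thesis, now importable by the lines
  of stmt-16312 and by route `WidthHaldane`.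
* `uniformFloor_of_perWidthFloor_of_gluing` — the STIFFNESS-ONLY corollary (instantiate `κ := 1`):
  per-width floors `d_M ≤ ρ_{L,M}` plus one-seam locality of `ρ` alone already give a width-uniform
  floor; useful to lines that split conjunct (i) from conjunct (ii).

Reading: with these in the tree the item stmt-16312 is, inside route `SeamInduction`, literally
`blocked on` stmt-18510 ∧ stmt-18509; nothing here touches the physics of either crux.
Real arithmetic and bookkeeping only; no definitions, no named facts. Proof of the abstract lemma
adapted from the kernel-checked `have key` of `Theses/SeamInduction.lean` (planner
plan-lens3-decomp-0, 2026-08-17), re-packaged pointwise in `(U, δ)`.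
-/

noncomputable section

namespace Summit.HubbardSuperconductivity.HubbardSuperconductivity.Theorems.WidthUniformThermodynamics

set_option linter.dupNamespace false -- summit = problem name (single-conjunct summit), D-0017

open scoped BigOperators Classical Matrix
open Summit.HubbardSuperconductivity.HubbardSuperconductivity.Theorems.WidthHaldane
open Summit.HubbardSuperconductivity.HubbardSuperconductivity.Theses.WidthHaldane
  (WidthUniformThermodynamics)
open Summit.HubbardSuperconductivity.HubbardSuperconductivity.Theses.SeamInduction
  (PerWidthThermodynamics SeamGluingLocality)

/-! ### The abstract width induction -/

/-- **Abstract width induction** (local + local-to-global in the width). Let `ρ, κ` be real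
functionals of an even tube `(L, M, Λ, e)`. Suppose (per-width data) every even width `M ≥ 2` has
constants `d_M > 0, k_M, L_M` with `d_M ≤ ρ`, `0 < κ ≤ k_M` for all even `L ≥ max(M, L_M)` and all
labellings, and (one-seam locality with constants `M₂, L₂`) for even `L ≥ L₂` and even
`M', M'' ≥ M₂` with `M' + M'' = M ≤ L`:
`(1 − M₂/M)·max(min(ρ_{M'}, ρ_{M''}), 0) ≤ ρ_M`, `(1 − M₂/M)·max(min(κ_{M'}, κ_{M''}), 0) ≤ κ_M`,
`κ_M ≤ (1 + M₂/M)·max(max(κ_{M'}, κ_{M''}), 0)`. Then there are `d₀ > 0, k₀, L₀` with `d₀ ≤ ρ`,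
`0 < κ ≤ k₀` for ALL even `L ≥ L₀`, all even `4M₂ + 12 ≤ M ≤ L`, all labellings. (Strong induction on
`M`: base window `[M₁, 2M₁+2]`, `M₁ = 4M₂ + 12`; step `M ↦ (2⌊M/4⌋, M − 2⌊M/4⌋)` with invariants
`ρ_M ≥ d₁(1/4 + M₂/(2M))`, `κ_M ≤ k₁(2 − 4M₂/M)`.) [folklore] -/
theorem uniform_of_perWidth_of_gluing
    (ρ κ : ∀ (L M : ℕ) [NeZero L] [NeZero M] (Λ : Type) [LinearOrder Λ] [Fintype Λ],
      (Λ ≃ ZMod L × ZMod M) → ℝ)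
    (hA : ∀ (M : ℕ) [NeZero M], Even M → 2 ≤ M → ∃ d : ℝ, 0 < d ∧ ∃ k : ℝ, ∃ L₁ : ℕ,
      ∀ (L : ℕ) [NeZero L], Even L → M ≤ L → L₁ ≤ L →
        ∀ (Λ : Type) [LinearOrder Λ] [Fintype Λ] (e : Λ ≃ ZMod L × ZMod M),
          d ≤ ρ L M Λ e ∧ 0 < κ L M Λ e ∧ κ L M Λ e ≤ k)
    (M₂ L₂ : ℕ)
    (hB : ∀ (L M' M'' M : ℕ) [NeZero L] [NeZero M'] [NeZero M''] [NeZero M], Even L → Even M' →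
      Even M'' → M₂ ≤ M' → M₂ ≤ M'' → M' + M'' = M → M ≤ L → L₂ ≤ L →
        ∀ (Λ' : Type) [LinearOrder Λ'] [Fintype Λ'] (e' : Λ' ≃ ZMod L × ZMod M')
          (Λ'' : Type) [LinearOrder Λ''] [Fintype Λ''] (e'' : Λ'' ≃ ZMod L × ZMod M'')
          (Λ : Type) [LinearOrder Λ] [Fintype Λ] (e : Λ ≃ ZMod L × ZMod M),
          (1 - (M₂ : ℝ) / M) * max (min (ρ L M' Λ' e') (ρ L M'' Λ'' e'')) 0 ≤ ρ L M Λ e ∧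
            (1 - (M₂ : ℝ) / M) * max (min (κ L M' Λ' e') (κ L M'' Λ'' e'')) 0 ≤ κ L M Λ e ∧
              κ L M Λ e ≤ (1 + (M₂ : ℝ) / M) * max (max (κ L M' Λ' e') (κ L M'' Λ'' e'')) 0) :
    ∃ d₀ : ℝ, 0 < d₀ ∧ ∃ k₀ : ℝ, ∃ L₀ : ℕ, ∀ (L M : ℕ) [NeZero L] [NeZero M], Even L → Even M →
      4 * M₂ + 12 ≤ M → M ≤ L → L₀ ≤ L →
        ∀ (Λ : Type) [LinearOrder Λ] [Fintype Λ] (e : Λ ≃ ZMod L × ZMod M),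
          d₀ ≤ ρ L M Λ e ∧ 0 < κ L M Λ e ∧ κ L M Λ e ≤ k₀ := by
  -- non-dependent choice of the per-width constants
  have hA' : ∀ M : ℕ, ∃ d : ℝ, ∃ k : ℝ, ∃ L₁ : ℕ, Even M → 2 ≤ M → 0 < d ∧
      ∀ L : ℕ, Even L → M ≤ L → L₁ ≤ L → ∀ (iL : NeZero L) (iM : NeZero M)
        (Λ : Type) [LinearOrder Λ] [Fintype Λ] (e : Λ ≃ ZMod L × ZMod M),
          d ≤ ρ L M Λ e ∧ 0 < κ L M Λ e ∧ κ L M Λ e ≤ k := by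
    intro M
    by_cases h : Even M ∧ 2 ≤ M
    · haveI : NeZero M := ⟨by omega⟩
      obtain ⟨d, hd, k, L₁, h1⟩ := hA M h.1 h.2
      exact ⟨d, k, L₁, fun _ _ => ⟨hd, fun L hLe hML hL1 iL iM Λ _ _ e => h1 L hLe hML hL1 Λ e⟩⟩
    · exact ⟨1, 1, 0, fun h1 h2 => (h ⟨h1, h2⟩).elim⟩
  choose d k L₁ hd using hA'
  set a : ℝ := (M₂ : ℝ) with ha'
  have ha : 0 ≤ a := by positivity
  set M₁ : ℕ := 4 * M₂ + 12 with hM₁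
  set I : Finset ℕ := Finset.range (M₁ / 2 + 2) with hI
  have hI0 : I.Nonempty := ⟨0, by simp [hI]⟩
  set w : ℕ → ℕ := fun i => M₁ + 2 * i with hw
  set d₁ : ℝ := I.inf' hI0 (fun i => d (w i)) with hd₁
  set k₁ : ℝ := I.sup' hI0 (fun i => k (w i))
  set L₀ : ℕ := max (I.sup (fun i => L₁ (w i))) L₂
  have hwE : ∀ i, Even (w i) := fun i => ⟨2 * M₂ + 6 + i, by simp [hw, hM₁]; ring⟩
  have hw2 : ∀ i, 2 ≤ w i := fun i => by simp only [hw]; omega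
  have hp : 0 < d₁ := by
    rw [hd₁, Finset.lt_inf'_iff]; exact fun i _ => (hd (w i) (hwE i) (hw2 i)).1
  have hdl : ∀ i ∈ I, d₁ ≤ d (w i) := fun i hi => Finset.inf'_le _ hi
  have hkg : ∀ i ∈ I, k (w i) ≤ k₁ := fun i hi => Finset.le_sup' (fun i => k (w i)) hi
  have hLb : ∀ i ∈ I, L₁ (w i) ≤ L₀ := fun i hi =>
    (Finset.le_sup (f := fun i => L₁ (w i)) hi).trans (le_max_left _ _)
  have hM₁a : 4 * a + 12 = (M₁ : ℝ) := by simp only [hM₁, ha']; push_cast; ring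
  -- canonical carriers for the parts
  have car : ∀ (L M : ℕ) [NeZero L] [NeZero M], ∃ e : Fin (L * M) ≃ ZMod L × ZMod M, True :=
    fun L M _ _ => ⟨finProdFinEquiv.symm.trans
      (Equiv.prodCongr (ZMod.finEquiv L).toEquiv (ZMod.finEquiv M).toEquiv), trivial⟩
  have hk0 : 0 ≤ k₁ := by
    obtain ⟨_, hb⟩ := hd (w 0) (hwE 0) (hw2 0)
    have hw0 := hw2 0
    haveI : NeZero (w 0) := ⟨by omega⟩
    haveI : NeZero (2 * (w 0 + L₁ (w 0))) := ⟨by omega⟩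
    obtain ⟨e, -⟩ := car (2 * (w 0 + L₁ (w 0))) (w 0)
    obtain ⟨-, h2, h3⟩ := hb (2 * (w 0 + L₁ (w 0))) (even_two_mul _) (by omega) (by omega)
      inferInstance inferInstance _ e
    exact (h2.le.trans h3).trans (hkg 0 (by simp [hI]))
  -- the two real step inequalities and the monotonicity of the invariants in the part width
  have slo : ∀ n : ℝ, 4 * a + 6 ≤ n → 0 < n →
      1 / 4 + a / (2 * n) ≤ (1 - a / n) * (1 / 4 + a / (n + 2)) := by
    intro n hn hn0
    have e1 : (1 - a / n) * (1 / 4 + a / (n + 2)) - (1 / 4 + a / (2 * n)) =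
        a * ((n - 6) - 4 * a) / (4 * n * (n + 2)) := by field_simp; ring
    have : 0 ≤ a * ((n - 6) - 4 * a) / (4 * n * (n + 2)) :=
      div_nonneg (mul_nonneg ha (by linarith)) (by positivity)
    linarith
  have shi : ∀ n : ℝ, 6 ≤ n → 0 < n → (1 + a / n) * (2 - 8 * a / (n + 2)) ≤ 2 - 4 * a / n := by
    intro n hn hn0
    have e1 : (2 - 4 * a / n) - (1 + a / n) * (2 - 8 * a / (n + 2)) =
        a * (2 * n - 12 + 8 * a) / (n * (n + 2)) := by field_simp; ring
    have : 0 ≤ a * (2 * n - 12 + 8 * a) / (n * (n + 2)) :=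
      div_nonneg (mul_nonneg ha (by nlinarith)) (by positivity)
    linarith
  have mlo : ∀ m n : ℝ, 0 < m → 2 * m ≤ n + 2 → a / (n + 2) ≤ a / (2 * m) :=
    fun m n hm hmn => div_le_div_of_nonneg_left ha (by positivity) hmn
  have mhi : ∀ m n : ℝ, 0 < m → 2 * m ≤ n + 2 → 2 - 4 * a / m ≤ 2 - 8 * a / (n + 2) := by
    intro m n hm hmn
    have : 8 * a / (n + 2) ≤ 4 * a / m := by
      rw [div_le_div_iff₀ (by linarith) hm]; nlinarith
    linarith
  -- the strong induction on the width with the two invariants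
  have main : ∀ M : ℕ, Even M → M₁ ≤ M → ∀ L : ℕ, Even L → M ≤ L → L₀ ≤ L →
      ∀ (iL : NeZero L) (iM : NeZero M) (Λ : Type) [LinearOrder Λ] [Fintype Λ]
        (e : Λ ≃ ZMod L × ZMod M),
        d₁ * (1 / 4 + a / (2 * M)) ≤ ρ L M Λ e ∧ 0 < κ L M Λ e ∧
          κ L M Λ e ≤ k₁ * (2 - 4 * a / M) := by
    intro M
    induction M using Nat.strong_induction_on with
    | _ M ih =>
      intro hMe hM₁M L hLe hML hL₀L iL iM Λ _ _ e
      obtain ⟨r, hr⟩ := hMe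
      have hM0 : (0 : ℝ) < M := by exact_mod_cast (show 0 < M by omega)
      have hM₁R : (M₁ : ℝ) ≤ M := by exact_mod_cast hM₁M
      have hL₂L : L₂ ≤ L := le_trans (le_max_right _ _) hL₀L
      by_cases hb : M ≤ 2 * M₁ + 2
      · -- base window: `M = w i` for some `i ∈ I`
        obtain ⟨i, hiI, hwi⟩ : ∃ i ∈ I, w i = M :=
          ⟨(M - M₁) / 2, by simp only [hI, Finset.mem_range]; omega, by simp only [hw]; omega⟩
        subst hwi
        obtain ⟨h1, h2, h3⟩ :=
          (hd (w i) (hwE i) (hw2 i)).2 L hLe hML ((hLb i hiI).trans hL₀L) iL iM Λ e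
        refine ⟨?_, h2, h3.trans ((hkg i hiI).trans (le_mul_of_one_le_right hk0 ?_))⟩
        · have : a / (2 * (w i : ℝ)) ≤ 1 / 2 := by rw [div_le_iff₀ (by positivity)]; linarith
          calc d₁ * (1 / 4 + a / (2 * (w i : ℝ)))
              ≤ d₁ * 1 := mul_le_mul_of_nonneg_left (by linarith) hp.le
            _ ≤ _ := by rw [mul_one]; exact (hdl i hiI).trans h1
        · have : 4 * a / (w i : ℝ) ≤ 1 := by rw [div_le_iff₀ hM0]; linarith
          linarith
      · -- induction step: glue the parts of widths `2⌊M/4⌋` and `M - 2⌊M/4⌋`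
        replace hb := not_le.mp hb
        have hbR : (2 * (M₁ : ℝ) + 2) < M := by exact_mod_cast hb
        set M' : ℕ := 2 * (M / 4) with hM'
        set M'' : ℕ := M - M' with hM''
        haveI iM' : NeZero M' := ⟨by omega⟩
        haveI iM'' : NeZero M'' := ⟨by omega⟩
        obtain ⟨e', -⟩ := car L M'
        obtain ⟨e'', -⟩ := car L M''
        obtain ⟨l', p', u'⟩ := ih M' (by omega) ⟨M / 4, by omega⟩ (by omega) L hLe (by omega) hL₀L
          iL iM' (Fin (L * M')) e'
        obtain ⟨l'', p'', u''⟩ := ih M'' (by omega) ⟨r - M / 4, by omega⟩ (by omega) L hLe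
          (by omega) hL₀L iL iM'' (Fin (L * M'')) e''
        obtain ⟨g1, g2, g3⟩ := hB L M' M'' M hLe ⟨M / 4, by omega⟩ ⟨r - M / 4, by omega⟩
          (by omega) (by omega) (by omega) hML hL₂L (Fin (L * M')) e' (Fin (L * M'')) e'' Λ e
        have hM'0 : (0 : ℝ) < M' := by exact_mod_cast (show 0 < M' by omega)
        have hM''0 : (0 : ℝ) < M'' := by exact_mod_cast (show 0 < M'' by omega)
        have h2M' : 2 * (M' : ℝ) ≤ M + 2 := by exact_mod_cast (show 2 * M' ≤ M + 2 by omega)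
        have h2M'' : 2 * (M'' : ℝ) ≤ M + 2 := by exact_mod_cast (show 2 * M'' ≤ M + 2 by omega)
        have hf : 0 < 1 - a / M := by
          have : a / M < 1 := by rw [div_lt_one hM0]; linarith
          linarith
        have hf' : 0 ≤ 1 + a / M := by positivity
        refine ⟨?_, lt_of_lt_of_le (mul_pos hf (lt_max_of_lt_left (lt_min p' p''))) g2, ?_⟩
        · have c' : d₁ * (1 / 4 + a / (M + 2)) ≤ ρ L M' (Fin (L * M')) e' :=
            le_trans (mul_le_mul_of_nonneg_left (by linarith [mlo M' M hM'0 h2M']) hp.le) l'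
          have c'' : d₁ * (1 / 4 + a / (M + 2)) ≤ ρ L M'' (Fin (L * M'')) e'' :=
            le_trans (mul_le_mul_of_nonneg_left (by linarith [mlo M'' M hM''0 h2M'']) hp.le) l''
          calc d₁ * (1 / 4 + a / (2 * M))
              ≤ d₁ * ((1 - a / M) * (1 / 4 + a / (M + 2))) :=
                mul_le_mul_of_nonneg_left (slo M (by linarith) hM0) hp.le
            _ = (1 - a / M) * (d₁ * (1 / 4 + a / (M + 2))) := by ring
            _ ≤ _ := (mul_le_mul_of_nonneg_left ((le_min c' c'').trans (le_max_left _ _))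
                hf.le).trans g1
        · have hB0 : 0 ≤ k₁ * (2 - 8 * a / (M + 2)) := by
            refine mul_nonneg hk0 ?_
            have : 8 * a / ((M : ℝ) + 2) ≤ 1 := by rw [div_le_one (by positivity)]; linarith
            linarith
          have c' : κ L M' (Fin (L * M')) e' ≤ k₁ * (2 - 8 * a / (M + 2)) :=
            u'.trans (mul_le_mul_of_nonneg_left (mhi M' M hM'0 h2M') hk0)
          have c'' : κ L M'' (Fin (L * M'')) e'' ≤ k₁ * (2 - 8 * a / (M + 2)) :=
            u''.trans (mul_le_mul_of_nonneg_left (mhi M'' M hM''0 h2M'') hk0)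
          calc _ ≤ (1 + a / M) * (k₁ * (2 - 8 * a / (M + 2))) :=
                g3.trans (mul_le_mul_of_nonneg_left (max_le (max_le c' c'') hB0) hf')
            _ = k₁ * ((1 + a / M) * (2 - 8 * a / (M + 2))) := by ring
            _ ≤ k₁ * (2 - 4 * a / M) := mul_le_mul_of_nonneg_left (shi M (by linarith) hM0) hk0
  refine ⟨d₁ / 4, by positivity, 2 * k₁, L₀, ?_⟩
  intro L M iL iM hLe hMe hM₁M hML hL₀L Λ _ _ e
  obtain ⟨h1, h2, h3⟩ := main M hMe hM₁M L hLe hML hL₀L iL iM Λ e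
  have hM0 : (0 : ℝ) < M := by exact_mod_cast Nat.pos_of_ne_zero (NeZero.ne M)
  have : 0 ≤ a / (2 * M) := by positivity
  have : 0 ≤ 4 * a / M := by positivity
  exact ⟨by nlinarith, h2, by nlinarith⟩

/-! ### Over the tube names, pointwise in `(U, δ)` -/

/-- **Width-uniform thermodynamics from per-width thermodynamics plus one-seam locality, at one
`(U, δ)`.** If at `(U, δ)` every even width `M ≥ 2` has `d_M ≤ ρ̃_{L,M}` and `0 < ẽ″_{L,M} ≤ k_M`
for all even `L ≥ max(M, L_M)` (every labelling), and one-seam locality holds at `(U, δ)` with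
constants `(M₂, L₂)`, then `UniformThermo U δ d₀ k₀ (4M₂ + 12) L₀` for some `d₀ > 0`, `k₀`, `L₀`.
[folklore] -/
theorem uniformThermo_of_perWidth_of_gluing (U δ : ℝ)
    (hA : ∀ (M : ℕ) [NeZero M], Even M → 2 ≤ M → ∃ d : ℝ, 0 < d ∧ ∃ k : ℝ, ∃ L₁ : ℕ,
      ∀ (L : ℕ) [NeZero L], Even L → M ≤ L → L₁ ≤ L →
        ∀ (Λ : Type) [LinearOrder Λ] [Fintype Λ] (e : Λ ≃ ZMod L × ZMod M),
          d ≤ tubeStiffness L M Λ e U δ ∧ 0 < tubePairCompressibility L M Λ e U δ ∧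
            tubePairCompressibility L M Λ e U δ ≤ k)
    (M₂ L₂ : ℕ)
    (hB : ∀ (L M' M'' M : ℕ) [NeZero L] [NeZero M'] [NeZero M''] [NeZero M], Even L → Even M' →
      Even M'' → M₂ ≤ M' → M₂ ≤ M'' → M' + M'' = M → M ≤ L → L₂ ≤ L →
        ∀ (Λ' : Type) [LinearOrder Λ'] [Fintype Λ'] (e' : Λ' ≃ ZMod L × ZMod M')
          (Λ'' : Type) [LinearOrder Λ''] [Fintype Λ''] (e'' : Λ'' ≃ ZMod L × ZMod M'')
          (Λ : Type) [LinearOrder Λ] [Fintype Λ] (e : Λ ≃ ZMod L × ZMod M),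
          (1 - (M₂ : ℝ) / M) *
                max (min (tubeStiffness L M' Λ' e' U δ) (tubeStiffness L M'' Λ'' e'' U δ)) 0 ≤
              tubeStiffness L M Λ e U δ ∧
            (1 - (M₂ : ℝ) / M) *
                  max (min (tubePairCompressibility L M' Λ' e' U δ)
                    (tubePairCompressibility L M'' Λ'' e'' U δ)) 0 ≤
                tubePairCompressibility L M Λ e U δ ∧
              tubePairCompressibility L M Λ e U δ ≤
                (1 + (M₂ : ℝ) / M) *
                  max (max (tubePairCompressibility L M' Λ' e' U δ)
                    (tubePairCompressibility L M'' Λ'' e'' U δ)) 0) :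
    ∃ d₀ : ℝ, 0 < d₀ ∧ ∃ k₀ : ℝ, ∃ L₀ : ℕ, UniformThermo U δ d₀ k₀ (4 * M₂ + 12) L₀ :=
  uniform_of_perWidth_of_gluing (fun L M _ _ Λ _ _ e => tubeStiffness L M Λ e U δ)
    (fun L M _ _ Λ _ _ e => tubePairCompressibility L M Λ e U δ) hA M₂ L₂ hB

/-! ### The target of route `SeamInduction` from its two cruxes -/

/-- **`X_of_subs` of route `SeamInduction`**: `PerWidthThermodynamics` (stmt-18510) and
`SeamGluingLocality` (stmt-18509) imply `WidthUniformThermodynamics` (stmt-16312, the `WidthHaldane`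
decl): take the `(U, δ)` of the per-width data, the `(M₂, L₂)` of one-seam locality there, and run
the width induction (`M₁ = 4M₂ + 12`). [folklore] -/
theorem widthUniformThermodynamics_of_perWidth_of_seamGluing (h2 : PerWidthThermodynamics)
    (h3 : SeamGluingLocality) : WidthUniformThermodynamics := by
  rw [widthUniformThermodynamics_iff]
  rw [perWidthThermodynamics_iff] at h2
  rw [seamGluingLocality_iff] at h3
  obtain ⟨U, hU, δ, hδ, hA⟩ := h2
  obtain ⟨M₂, L₂, hB⟩ := h3 U hU δ hδ
  obtain ⟨d₀, hd₀, k₀, L₀, h⟩ := uniformThermo_of_perWidth_of_gluing U δ hA M₂ L₂ hB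
  exact ⟨U, hU, δ, hδ, d₀, hd₀, k₀, 4 * M₂ + 12, L₀, h⟩

/-- **The target of route `SeamInduction` from its cruxes** (the `SeamInduction` copy of the decl,
definitionally the `WidthHaldane` one): `PerWidthThermodynamics → SeamGluingLocality →
SeamInduction.WidthUniformThermodynamics`. [folklore] -/
theorem seamInduction_widthUniformThermodynamics_of_cruxes (h2 : PerWidthThermodynamics)
    (h3 : SeamGluingLocality) :
    Summit.HubbardSuperconductivity.HubbardSuperconductivity.Theses.SeamInduction.WidthUniformThermodynamics :=
  seamInduction_widthUniformThermodynamics_iff.2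
    (widthUniformThermodynamics_of_perWidth_of_seamGluing h2 h3)

/-! ### Stiffness-only corollary -/

/-- **Width-uniform floor from per-width floors plus one-seam locality of one functional.** For a
single width-indexed functional `ρ`: per-width floors `0 < d_M ≤ ρ_{L,M}` (even `L ≥ max(M, L_M)`,
every labelling) for every even `M ≥ 2`, plus
`(1 − M₂/M)·max(min(ρ_{M'}, ρ_{M''}), 0) ≤ ρ_{M'+M''}` for even `M', M'' ≥ M₂`, `M' + M'' ≤ L`,
`L ≥ L₂` even, give a width-uniform floor `d₀ ≤ ρ_{L,M}` on all even `4M₂ + 12 ≤ M ≤ L`, `L ≥ L₀`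
even (the abstract induction with `κ := 1`). [folklore] -/
theorem uniformFloor_of_perWidthFloor_of_gluing
    (ρ : ∀ (L M : ℕ) [NeZero L] [NeZero M] (Λ : Type) [LinearOrder Λ] [Fintype Λ],
      (Λ ≃ ZMod L × ZMod M) → ℝ)
    (hA : ∀ (M : ℕ) [NeZero M], Even M → 2 ≤ M → ∃ d : ℝ, 0 < d ∧ ∃ L₁ : ℕ,
      ∀ (L : ℕ) [NeZero L], Even L → M ≤ L → L₁ ≤ L →
        ∀ (Λ : Type) [LinearOrder Λ] [Fintype Λ] (e : Λ ≃ ZMod L × ZMod M), d ≤ ρ L M Λ e)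
    (M₂ L₂ : ℕ)
    (hB : ∀ (L M' M'' M : ℕ) [NeZero L] [NeZero M'] [NeZero M''] [NeZero M], Even L → Even M' →
      Even M'' → M₂ ≤ M' → M₂ ≤ M'' → M' + M'' = M → M ≤ L → L₂ ≤ L →
        ∀ (Λ' : Type) [LinearOrder Λ'] [Fintype Λ'] (e' : Λ' ≃ ZMod L × ZMod M')
          (Λ'' : Type) [LinearOrder Λ''] [Fintype Λ''] (e'' : Λ'' ≃ ZMod L × ZMod M'')
          (Λ : Type) [LinearOrder Λ] [Fintype Λ] (e : Λ ≃ ZMod L × ZMod M),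
          (1 - (M₂ : ℝ) / M) * max (min (ρ L M' Λ' e') (ρ L M'' Λ'' e'')) 0 ≤ ρ L M Λ e) :
    ∃ d₀ : ℝ, 0 < d₀ ∧ ∃ L₀ : ℕ, ∀ (L M : ℕ) [NeZero L] [NeZero M], Even L → Even M →
      4 * M₂ + 12 ≤ M → M ≤ L → L₀ ≤ L →
        ∀ (Λ : Type) [LinearOrder Λ] [Fintype Λ] (e : Λ ≃ ZMod L × ZMod M), d₀ ≤ ρ L M Λ e := by
  have hA1 : ∀ (M : ℕ) [NeZero M], Even M → 2 ≤ M → ∃ d : ℝ, 0 < d ∧ ∃ k : ℝ, ∃ L₁ : ℕ,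
      ∀ (L : ℕ) [NeZero L], Even L → M ≤ L → L₁ ≤ L →
        ∀ (Λ : Type) [LinearOrder Λ] [Fintype Λ] (e : Λ ≃ ZMod L × ZMod M),
          d ≤ ρ L M Λ e ∧ (0 : ℝ) < (fun (L M : ℕ) [NeZero L] [NeZero M] (Λ : Type)
            [LinearOrder Λ] [Fintype Λ] (_ : Λ ≃ ZMod L × ZMod M) => (1 : ℝ)) L M Λ e ∧
            (fun (L M : ℕ) [NeZero L] [NeZero M] (Λ : Type) [LinearOrder Λ] [Fintype Λ]
              (_ : Λ ≃ ZMod L × ZMod M) => (1 : ℝ)) L M Λ e ≤ k := by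
    intro M _ hMe hM2
    obtain ⟨d, hd, L₁, h⟩ := hA M hMe hM2
    exact ⟨d, hd, 1, L₁, fun L _ hLe hML hL1 Λ _ _ e => ⟨h L hLe hML hL1 Λ e, one_pos, le_rfl⟩⟩
  have hB1 : ∀ (L M' M'' M : ℕ) [NeZero L] [NeZero M'] [NeZero M''] [NeZero M], Even L → Even M' →
      Even M'' → M₂ ≤ M' → M₂ ≤ M'' → M' + M'' = M → M ≤ L → L₂ ≤ L →
        ∀ (Λ' : Type) [LinearOrder Λ'] [Fintype Λ'] (e' : Λ' ≃ ZMod L × ZMod M')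
          (Λ'' : Type) [LinearOrder Λ''] [Fintype Λ''] (e'' : Λ'' ≃ ZMod L × ZMod M'')
          (Λ : Type) [LinearOrder Λ] [Fintype Λ] (e : Λ ≃ ZMod L × ZMod M),
          (1 - (M₂ : ℝ) / M) * max (min (ρ L M' Λ' e') (ρ L M'' Λ'' e'')) 0 ≤ ρ L M Λ e ∧
            (1 - (M₂ : ℝ) / M) * max (min (1 : ℝ) 1) 0 ≤ 1 ∧
              (1 : ℝ) ≤ (1 + (M₂ : ℝ) / M) * max (max (1 : ℝ) 1) 0 := by
    intro L M' M'' M _ _ _ _ hLe hM'e hM''e h1 h2 hsum hML hL2 Λ' _ _ e' Λ'' _ _ e'' Λ _ _ e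
    have hq : (0 : ℝ) ≤ (M₂ : ℝ) / M := by positivity
    refine ⟨hB L M' M'' M hLe hM'e hM''e h1 h2 hsum hML hL2 Λ' e' Λ'' e'' Λ e, ?_, ?_⟩
    · rw [min_self, max_eq_left zero_le_one, mul_one]; linarith
    · rw [max_self, max_eq_left zero_le_one, mul_one]; linarith
  obtain ⟨d₀, hd₀, _k₀, L₀, h⟩ := uniform_of_perWidth_of_gluing ρ
    (fun (L M : ℕ) [NeZero L] [NeZero M] (Λ : Type) [LinearOrder Λ] [Fintype Λ]
      (_ : Λ ≃ ZMod L × ZMod M) => (1 : ℝ)) hA1 M₂ L₂ hB1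
  exact ⟨d₀, hd₀, L₀, fun L M _ _ hLe hMe hM hML hL0 Λ _ _ e => (h L M hLe hMe hM hML hL0 Λ e).1⟩

end Summit.HubbardSuperconductivity.HubbardSuperconductivity.Theorems.WidthUniformThermodynamics

end
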